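import Literature.AnabelianGeometry.AbsoluteAnabelian.MLFGaloisTLGUnitsFunctor
import Literature.AnabelianGeometry.AbsoluteAnabelian.MLFGaloisIntegersFunctor
import Literature.AnabelianGeometry.AbsoluteAnabelian.MLFGaloisMonoAnalyticModel
import Literature.AnabelianGeometry.AbsoluteAnabelian.MLFGaloisPairsWitness
import Mathlib.FieldTheory.Galois.Profinite

/-!
# Non-vacuity of the domains of the Def 3.1 (iii) functors `tfToTM`, `tlgToTCG` (compact Galois group)

Proof-only companion (no definitions) of `MLFGaloisIntegersFunctor.lean` / `MLFGaloisTLGUnitsFunctor.lean`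
(seat abc-iut-L4-t2; S. Mochizuki, *Topics in absolute anabelian geometry III*, Def. 3.1 (i)–(iii)
pp. 66–68, bib key `MochizukiAbsTopIII2015`).  The natural functors `𝒞_TF → 𝒞_TM` and `𝒞_TLG → 𝒞_TCG`
are typed on the full subcategories of MLF-Galois pairs with COMPACT Galois group
(`MLFGaloisFieldPairCompactCat`, `MLFGaloisMonoidPairCompactCat T`).  These categories are INHABITED by
genuine data: the mono-analytic model `(G_k ↷ k̄)`, `(G_k ↷ 𝒪_k̄^⊳)`, `(G_k ↷ k̄^×)`, `(G_k ↷ 𝒪_k̄^×)` of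
`MLFGaloisMonoAnalyticModel.lean` over `k = ℚ₂`, `k̄ = ℚ̄₂` (`MLFClosure.ofPadic 2`,
`MLFGaloisPairsWitness.lean`), whose Galois group `G_k` is compact (Krull topology; Mathlib
`CompactSpace Gal(K/k)`).  Hence `tfToTM`, `tlgToTCG` (and `tmToTLG`, `tmToTCG` restricted) act on
non-empty categories, and their object parts are exercised on a concrete pair.

HONEST FRAMING: vacuity guard over OUR kernel definitions; nothing here bears on [IUTchIII] Cor. 3.12.
-/

noncomputable section

namespace Literature.AnabelianGeometry.AbsoluteAnabelian

open _root_.CategoryTheory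

/-- The Galois group of the mono-analytic model `(G_k ↷ k̄)` is compact (Krull topology).
[cite: MochizukiAbsTopIII2015, Definition 3.1 (i) p.66] -/
theorem compactSpace_galois_Pi (C : MLFClosure.{0}) :
    CompactSpace (ModelMLFGaloisData.galois C.k C.K).Pi :=
  inferInstanceAs (CompactSpace (C.K ≃ₐ[C.k] C.K))

/-- **`MLFGaloisFieldPairCompactCat` is inhabited**: `(G_k ↷ k̄)` for `k = ℚ₂` is an MLF-Galois `TF`-pair
with compact Galois group. [cite: MochizukiAbsTopIII2015, Definition 3.1 (ii) p.67] -/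
theorem nonempty_mlfGaloisFieldPairCompactCat : Nonempty MLFGaloisFieldPairCompactCat.{0} :=
  ⟨⟨(ModelMLFGaloisData.galois (MLFClosure.ofPadic 2).k (MLFClosure.ofPadic 2).K).fieldPair,
    isMLFGaloisFieldPair_galois (MLFClosure.ofPadic 2), compactSpace_galois_Pi (MLFClosure.ofPadic 2)⟩⟩

/-- **`MLFGaloisMonoidPairCompactCat TM` is inhabited**: `(G_k ↷ 𝒪_k̄^⊳)` for `k = ℚ₂`.
[cite: MochizukiAbsTopIII2015, Definition 3.1 (ii) p.67] -/
theorem nonempty_mlfGaloisMonoidPairCompactCat_TM : Nonempty (MLFGaloisMonoidPairCompactCat.{0} .TM) :=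
  ⟨⟨(ModelMLFGaloisData.galois (MLFClosure.ofPadic 2).k (MLFClosure.ofPadic 2).K).tmPair,
    isMLFGaloisMonoidPair_galois_tmPair (MLFClosure.ofPadic 2), compactSpace_galois_Pi (MLFClosure.ofPadic 2)⟩⟩

/-- **`MLFGaloisMonoidPairCompactCat TLG` is inhabited**: `(G_k ↷ k̄^×)` for `k = ℚ₂` (the domain of
`tlgToTCG` is non-empty). [cite: MochizukiAbsTopIII2015, Definition 3.1 (ii) p.67] -/
theorem nonempty_mlfGaloisMonoidPairCompactCat_TLG : Nonempty (MLFGaloisMonoidPairCompactCat.{0} .TLG) :=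
  ⟨⟨(ModelMLFGaloisData.galois (MLFClosure.ofPadic 2).k (MLFClosure.ofPadic 2).K).tlgPair,
    isMLFGaloisMonoidPair_galois_tlgPair (MLFClosure.ofPadic 2), compactSpace_galois_Pi (MLFClosure.ofPadic 2)⟩⟩

/-- **`MLFGaloisMonoidPairCompactCat TCG` is inhabited**: `(G_k ↷ 𝒪_k̄^×)` for `k = ℚ₂`.
[cite: MochizukiAbsTopIII2015, Definition 3.1 (ii) p.67] -/
theorem nonempty_mlfGaloisMonoidPairCompactCat_TCG : Nonempty (MLFGaloisMonoidPairCompactCat.{0} .TCG) :=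
  ⟨⟨(ModelMLFGaloisData.galois (MLFClosure.ofPadic 2).k (MLFClosure.ofPadic 2).K).tcgPair,
    isMLFGaloisMonoidPair_galois_tcgPair (MLFClosure.ofPadic 2), compactSpace_galois_Pi (MLFClosure.ofPadic 2)⟩⟩

/-- The object part of `tfToTM` exercised on the witness: its value on `(G_k ↷ k̄)` is the pair of
intrinsic non-zero integers, an MLF-Galois `TM`-pair. [cite: MochizukiAbsTopIII2015, Definition 3.1 (iii) p.68] -/
theorem tfToTM_obj_witness :
    IsMLFGaloisMonoidPair .TM
      (tfToTM.{0}.obj ⟨(ModelMLFGaloisData.galois (MLFClosure.ofPadic 2).k (MLFClosure.ofPadic 2).K).fieldPair,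
        isMLFGaloisFieldPair_galois (MLFClosure.ofPadic 2), compactSpace_galois_Pi (MLFClosure.ofPadic 2)⟩).obj :=
  (tfToTM.{0}.obj _).property

/-- The object part of `tlgToTCG` exercised on the witness `(G_k ↷ k̄^×)`.
[cite: MochizukiAbsTopIII2015, Definition 3.1 (iii) p.68] -/
theorem tlgToTCG_obj_witness :
    IsMLFGaloisMonoidPair .TCG
      (tlgToTCG.{0}.obj ⟨(ModelMLFGaloisData.galois (MLFClosure.ofPadic 2).k (MLFClosure.ofPadic 2).K).tlgPair,
        isMLFGaloisMonoidPair_galois_tlgPair (MLFClosure.ofPadic 2), compactSpace_galois_Pi (MLFClosure.ofPadic 2)⟩).obj :=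
  (tlgToTCG.{0}.obj _).property

end Literature.AnabelianGeometry.AbsoluteAnabelian

end
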